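import Literature.IUT.HodgeTheaters.PiAvatarRankOneExponent
import Literature.IUT.HodgeTheaters.LabelsPlusMinusUnitEquivariant

/-!
# [IUTchI] Def 6.1 (v): the exponent character `N_A(X) ⊓ N_A(Y) → (ℤ/l)^×` and `toFlStarOfNormalizer` (DEFINITIONS)

S. Mochizuki, *Inter-universal Teichmüller theory I*, kurims manuscript (May 2020), §6 Definition 6.1 (v)
p. 158: "this rank one quotient determines a natural surjective homomorphism `Aut(𝒟^{⊚±}) ↠ 𝔽_l^⋇` [which may be
reconstructed category-theoretically from `𝒟^{⊚±}`!] — whose kernel we denote by `Aut_±(𝒟^{⊚±})`"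
([IUTchI] Def 6.1 (v) p.158) [claim: Mochizuki2012, status: disputed] (D-0012 claim key, series status DISPUTED —
this file is FINITE GROUP THEORY; nothing of the series is asserted and no side is taken on [IUTchIII] Cor. 3.12).

## What (KIT-INSTANCE row D13-P3-v, abc-iut-L5-t4 lemma list 03:58:14Z items (L1), (L2), (L3); abc-iut-L5-lead
RULINGS #28 (2): the DEFINITIONS part, post-05:00Z window, additive — every proof obligation is discharged by the
proof-only companions `PiAvatarRankOneExponent.lean` / `LabelsPlusMinusUnitEquivariant.lean`)

* (L1) `mulAutExponent hQ : MulAut Q →* (ℤ/l)^×` for a group `Q` with `Nat.card Q = l` prime — `φ ↦` the unique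
  unit `u` with `φ = (· ^ u)` (`mulAutExponent_spec`, `mulAutExponent_eq_iff`, injective);
* (L2) for subgroups `Y ≤ X ≤ A`, `Y ⊴ X` of prime index `l`: `conjSubquotHom n` — conjugation by an element `n`
  of the joint normaliser as an endomorphism of `X ⧸ Y`, `conjSubquot` — the same as an element of `MulAut (X ⧸ Y)`
  and as a homomorphism `↥(N_A(X) ⊓ N_A(Y)) →* MulAut (X ⧸ Y)`; `conjExponent` — the composite with (L1), i.e. the
  exponent character `↥(N_A(X) ⊓ N_A(Y)) →* (ℤ/l)^×` (`conjExponent_spec`: `n k n⁻¹ ≡ k^{χ(n)} (mod Y)`;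
  `conjExponent_eq_one_of_mem`: trivial on `X` (L2a/b); `conjExponent_mul_of_mem`: constant on `X`-cosets;
  `conjExponent_eq_one_iff`);
* (L3) `toFlStarOfNormalizer := (𝔽_l^× ↠ 𝔽_l^⋇) ∘ conjExponent : ↥(N_A(X) ⊓ N_A(Y)) →* 𝔽_l^⋇` with
  `toFlStarOfNormalizer_eq_one_of_mem` (`n ∈ X ⇒ 1`), `…_eq_one_iff` (`χ(n) = ±1` — the `Aut_±` shape),
  `…_surjective_iff` (every unit up to sign — the split-torus sentence of Def 3.1 (c), left to the binding).

At the instance (abc-iut-L5-t4 P5-binding): `A = Π_{C_F}`, `Y = Π_{X̲_K}`, `X = Π_{X_K}`, `gModel = OrbitCat.of Y`,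
`Aut(gModel) = (N_A(Y)/Y)ᵒᵖ` via `OrbitCat.autOfNormalizer`; `toFlStar` = `toFlStarOfNormalizer` read on a normaliser
representative (well defined by `conjExponent_mul_of_mem`; the ᵒᵖ is immaterial, `𝔽_l^⋇` being abelian).
No instance, no notation, no `Prop` fact. typed ≠ proved elsewhere.
-/

namespace Literature.IUT.HodgeTheaters

/-! ### (L1) the canonical exponent of an automorphism of a group of prime order -/

section PrimeOrder

variable {l : ℕ} [hp : Fact l.Prime] {Q : Type*} [Group Q]

/-- **(L1)** The canonical exponent `MulAut Q → (ℤ/l)^×` of a group `Q` of prime order `l`: `φ ↦` the unique unit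
`u` with `φ q = q^u` for all `q` ([IUTchI] Def 6.1 (v) p.158: the action on the rank one quotient is a scalar).
([IUTchI] Def 6.1 (v) p.158) [claim: Mochizuki2012, status: disputed] -/
noncomputable def mulAutExponent (hQ : Nat.card Q = l) : MulAut Q →* (ZMod l)ˣ where
  toFun φ := (exists_unique_units_pow_eq hQ φ).choose
  map_one' := ((exists_unique_units_pow_eq hQ 1).choose_spec.2 1 fun q =>
    (pow_units_val_one q).symm).symm ▸ rfl
  map_mul' φ ψ := by
    have hφ := (exists_unique_units_pow_eq hQ φ).choose_spec.1
    have hψ := (exists_unique_units_pow_eq hQ ψ).choose_spec.1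
    refine ((exists_unique_units_pow_eq hQ (φ * ψ)).choose_spec.2 _ fun q => ?_).symm ▸ rfl
    rw [MulAut.mul_apply, hψ, map_pow, hφ, ← pow_units_val_mul hQ, mul_comm]

/-- Defining property of the exponent: `φ q = q ^ (mulAutExponent φ)`.
([IUTchI] Def 6.1 (v) p.158) [claim: Mochizuki2012, status: disputed] -/
theorem mulAutExponent_spec (hQ : Nat.card Q = l) (φ : MulAut Q) (q : Q) :
    φ q = q ^ ((mulAutExponent hQ φ : (ZMod l)ˣ) : ZMod l).val :=
  (exists_unique_units_pow_eq hQ φ).choose_spec.1 q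

/-- The exponent is CHARACTERISED by its defining property (canonicity: no generator chosen).
([IUTchI] Def 6.1 (v) p.158) [claim: Mochizuki2012, status: disputed] -/
theorem mulAutExponent_eq_iff (hQ : Nat.card Q = l) (φ : MulAut Q) (u : (ZMod l)ˣ) :
    mulAutExponent hQ φ = u ↔ ∀ q : Q, φ q = q ^ (u : ZMod l).val := by
  constructor
  · rintro rfl
    exact mulAutExponent_spec hQ φ
  · intro h
    exact ((exists_unique_units_pow_eq hQ φ).choose_spec.2 u h).symm

/-- An automorphism is determined by its exponent. ([IUTchI] Def 6.1 (v) p.158) [claim: Mochizuki2012, status: disputed] -/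
theorem mulAutExponent_injective (hQ : Nat.card Q = l) : Function.Injective (mulAutExponent hQ) := by
  intro φ ψ h
  ext q
  rw [mulAutExponent_spec hQ φ, mulAutExponent_spec hQ ψ, h]

end PrimeOrder

/-! ### (L2) conjugation on a prime-index subquotient; (L3) the character to `𝔽_l^⋇` -/

section Subquotient

variable {A : Type*} [Group A] {Y X : Subgroup A} {l : ℕ} [hp : Fact l.Prime]

/-- Conjugation by an element normalising `X`, as a homomorphism `X → X ⧸ Y` (`k ↦ (n k n⁻¹) Y`).
([IUTchI] Def 6.1 (v) p.158) [claim: Mochizuki2012, status: disputed] -/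
def conjToSubquot (Y X : Subgroup A) [(Y.subgroupOf X).Normal] (n : A)
    (hnX : n ∈ Subgroup.normalizer (X : Set A)) : X →* X ⧸ Y.subgroupOf X where
  toFun k := QuotientGroup.mk ⟨n * k * n⁻¹, (Subgroup.mem_normalizer_iff.mp hnX k).mp k.2⟩
  map_one' := by
    rw [← QuotientGroup.mk_one]
    congr 1
    exact Subtype.ext (by simp)
  map_mul' a b := by
    rw [← QuotientGroup.mk_mul]
    congr 1
    exact Subtype.ext (by simp [mul_assoc])

/-- `conjToSubquot n k = (n k n⁻¹) Y`. ([IUTchI] Def 6.1 (v) p.158) [claim: Mochizuki2012, status: disputed] -/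
theorem conjToSubquot_apply [(Y.subgroupOf X).Normal] (n : A) (hnX : n ∈ Subgroup.normalizer (X : Set A))
    (k : X) : conjToSubquot Y X n hnX k =
      QuotientGroup.mk ⟨n * k * n⁻¹, (Subgroup.mem_normalizer_iff.mp hnX k).mp k.2⟩ := rfl

/-- An element normalising `Y` as well kills `Y ⧸ Y`: `Y ≤ Ker(conjToSubquot n)`.
([IUTchI] Def 6.1 (v) p.158) [claim: Mochizuki2012, status: disputed] -/
theorem subgroupOf_le_ker_conjToSubquot [(Y.subgroupOf X).Normal] (n : A)
    (hnX : n ∈ Subgroup.normalizer (X : Set A)) (hnY : n ∈ Subgroup.normalizer (Y : Set A)) :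
    Y.subgroupOf X ≤ (conjToSubquot Y X n hnX).ker := by
  intro y hy
  rw [Subgroup.mem_subgroupOf] at hy
  rw [MonoidHom.mem_ker, conjToSubquot_apply, QuotientGroup.eq_one_iff, Subgroup.mem_subgroupOf]
  exact (Subgroup.mem_normalizer_iff.mp hnY y).mp hy

/-- **(L2)** Conjugation by `n ∈ N_A(X) ⊓ N_A(Y)` as an ENDOMORPHISM of the subquotient `X ⧸ Y`.
([IUTchI] Def 6.1 (v) p.158) [claim: Mochizuki2012, status: disputed] -/
def conjSubquotHom (Y X : Subgroup A) [(Y.subgroupOf X).Normal] (n : A)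
    (hnX : n ∈ Subgroup.normalizer (X : Set A)) (hnY : n ∈ Subgroup.normalizer (Y : Set A)) :
    X ⧸ Y.subgroupOf X →* X ⧸ Y.subgroupOf X :=
  QuotientGroup.lift _ (conjToSubquot Y X n hnX) (subgroupOf_le_ker_conjToSubquot n hnX hnY)

/-- `conjSubquotHom n (k Y) = (n k n⁻¹) Y`. ([IUTchI] Def 6.1 (v) p.158) [claim: Mochizuki2012, status: disputed] -/
theorem conjSubquotHom_mk [(Y.subgroupOf X).Normal] (n : A) (hnX : n ∈ Subgroup.normalizer (X : Set A))
    (hnY : n ∈ Subgroup.normalizer (Y : Set A)) (k : X) :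
    conjSubquotHom Y X n hnX hnY (QuotientGroup.mk k) =
      QuotientGroup.mk ⟨n * k * n⁻¹, (Subgroup.mem_normalizer_iff.mp hnX k).mp k.2⟩ := rfl

/-- `conjSubquotHom n` is injective (`n k n⁻¹ ∈ Y ⇒ k ∈ Y`).
([IUTchI] Def 6.1 (v) p.158) [claim: Mochizuki2012, status: disputed] -/
theorem conjSubquotHom_injective [(Y.subgroupOf X).Normal] (n : A)
    (hnX : n ∈ Subgroup.normalizer (X : Set A)) (hnY : n ∈ Subgroup.normalizer (Y : Set A)) :
    Function.Injective (conjSubquotHom Y X n hnX hnY) := by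
  rw [injective_iff_map_eq_one]
  intro q hq
  induction q using QuotientGroup.induction_on with
  | H k =>
    rw [conjSubquotHom_mk, QuotientGroup.eq_one_iff, Subgroup.mem_subgroupOf] at hq
    rw [QuotientGroup.eq_one_iff, Subgroup.mem_subgroupOf]
    exact (Subgroup.mem_normalizer_iff.mp hnY k).mpr hq

/-- For `X ⧸ Y` of prime order (indeed for any finite index) `conjSubquotHom n` is bijective.
([IUTchI] Def 6.1 (v) p.158) [claim: Mochizuki2012, status: disputed] -/
theorem conjSubquotHom_bijective [(Y.subgroupOf X).Normal] (hidx : Y.relIndex X = l) (n : A)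
    (hnX : n ∈ Subgroup.normalizer (X : Set A)) (hnY : n ∈ Subgroup.normalizer (Y : Set A)) :
    Function.Bijective (conjSubquotHom Y X n hnX hnY) := by
  have hQ : Nat.card (X ⧸ Y.subgroupOf X) = l := hidx
  haveI : Finite (X ⧸ Y.subgroupOf X) := Nat.finite_of_card_ne_zero (hQ ▸ hp.out.ne_zero)
  exact ⟨conjSubquotHom_injective n hnX hnY,
    Finite.injective_iff_surjective.mp (conjSubquotHom_injective n hnX hnY)⟩

variable (Y X) in
/-- **(L2)** Conjugation by the joint normaliser `N_A(X) ⊓ N_A(Y)` as a homomorphism to `MulAut (X ⧸ Y)`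
([IUTchI] Def 6.1 (v) p.158: `Aut(𝒟^{⊚±})` acting on the rank one quotient).
([IUTchI] Def 6.1 (v) p.158) [claim: Mochizuki2012, status: disputed] -/
noncomputable def conjSubquot [(Y.subgroupOf X).Normal] (hidx : Y.relIndex X = l) :
    ↥(Subgroup.normalizer (X : Set A) ⊓ Subgroup.normalizer (Y : Set A)) →* MulAut (X ⧸ Y.subgroupOf X) where
  toFun n := MulEquiv.ofBijective (conjSubquotHom Y X n.1 n.2.1 n.2.2)
    (conjSubquotHom_bijective hidx n.1 n.2.1 n.2.2)
  map_one' := by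
    ext q
    induction q using QuotientGroup.induction_on with
    | H k =>
      rw [MulEquiv.ofBijective_apply, MulAut.one_apply, conjSubquotHom_mk]
      congr 1
      exact Subtype.ext (by simp)
  map_mul' n m := by
    ext q
    induction q using QuotientGroup.induction_on with
    | H k =>
      rw [MulEquiv.ofBijective_apply, MulAut.mul_apply, MulEquiv.ofBijective_apply,
        MulEquiv.ofBijective_apply, conjSubquotHom_mk, conjSubquotHom_mk, conjSubquotHom_mk]
      congr 1
      exact Subtype.ext (by simp [mul_assoc])

/-- `conjSubquot n (k Y) = (n k n⁻¹) Y`. ([IUTchI] Def 6.1 (v) p.158) [claim: Mochizuki2012, status: disputed] -/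
theorem conjSubquot_apply_mk [(Y.subgroupOf X).Normal] (hidx : Y.relIndex X = l)
    (n : ↥(Subgroup.normalizer (X : Set A) ⊓ Subgroup.normalizer (Y : Set A))) (k : X) :
    conjSubquot Y X hidx n (QuotientGroup.mk k) =
      QuotientGroup.mk ⟨(n : A) * k * (n : A)⁻¹, (Subgroup.mem_normalizer_iff.mp n.2.1 k).mp k.2⟩ := rfl

/-- **(L2a/b)** Elements of `X` act TRIVIALLY on `X ⧸ Y` (prime order ⇒ abelian; inner automorphisms).
([IUTchI] Def 6.1 (v) p.158) [claim: Mochizuki2012, status: disputed] -/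
theorem conjSubquot_eq_one_of_mem (hYX : Y ≤ X) [(Y.subgroupOf X).Normal] (hidx : Y.relIndex X = l)
    (n : ↥(Subgroup.normalizer (X : Set A) ⊓ Subgroup.normalizer (Y : Set A))) (hn : (n : A) ∈ X) :
    conjSubquot Y X hidx n = 1 := by
  ext q
  induction q using QuotientGroup.induction_on with
  | H k =>
    rw [conjSubquot_apply_mk, MulAut.one_apply, QuotientGroup.eq, Subgroup.mem_subgroupOf,
      Subgroup.coe_mul, Subgroup.coe_inv]
    have h := conj_pow_mem_of_mem hYX hidx hn k k.2
    rw [pow_units_val_one] at h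
    -- `(n k n⁻¹)⁻¹ k ∈ Y` from `k⁻¹ (n k n⁻¹) ∈ Y`
    simpa [mul_assoc] using Y.inv_mem h

variable (Y X) in
/-- **(L1)∘(L2): the exponent character** `N_A(X) ⊓ N_A(Y) → (ℤ/l)^×`, `n ↦` the unit `u` with
`n k n⁻¹ ≡ k^u (mod Y)` for all `k ∈ X` ([IUTchI] Def 6.1 (v) p.158: the scalar on the rank one quotient).
([IUTchI] Def 6.1 (v) p.158) [claim: Mochizuki2012, status: disputed] -/
noncomputable def conjExponent (hYX : Y ≤ X) [(Y.subgroupOf X).Normal] (hidx : Y.relIndex X = l) :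
    ↥(Subgroup.normalizer (X : Set A) ⊓ Subgroup.normalizer (Y : Set A)) →* (ZMod l)ˣ where
  toFun n := (exists_unique_conj_pow_mem hYX hidx n.2.1 n.2.2).choose
  map_one' := by
    have h1 : ((1 : ↥(Subgroup.normalizer (X : Set A) ⊓ Subgroup.normalizer (Y : Set A))) : A) ∈ X := by
      rw [OneMemClass.coe_one]
      exact X.one_mem
    exact ((exists_unique_conj_pow_mem hYX hidx
      (1 : ↥(Subgroup.normalizer (X : Set A) ⊓ Subgroup.normalizer (Y : Set A))).2.1
      (1 : ↥(Subgroup.normalizer (X : Set A) ⊓ Subgroup.normalizer (Y : Set A))).2.2).choose_spec.2 1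
      (conj_pow_mem_of_mem hYX hidx h1)).symm
  map_mul' n m := by
    have hn := (exists_unique_conj_pow_mem hYX hidx n.2.1 n.2.2).choose_spec.1
    have hm := (exists_unique_conj_pow_mem hYX hidx m.2.1 m.2.2).choose_spec.1
    exact ((exists_unique_conj_pow_mem hYX hidx (n * m).2.1 (n * m).2.2).choose_spec.2 _
      (conj_pow_mem_mul hYX hidx n.2.1 n.2.2 hn hm)).symm ▸ rfl

/-- Defining property: `n k n⁻¹ ≡ k ^ (conjExponent n) (mod Y)` for `k ∈ X`.
([IUTchI] Def 6.1 (v) p.158) [claim: Mochizuki2012, status: disputed] -/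
theorem conjExponent_spec (hYX : Y ≤ X) [(Y.subgroupOf X).Normal] (hidx : Y.relIndex X = l)
    (n : ↥(Subgroup.normalizer (X : Set A) ⊓ Subgroup.normalizer (Y : Set A))) :
    ∀ k ∈ X, (k ^ ((conjExponent Y X hYX hidx n : (ZMod l)ˣ) : ZMod l).val)⁻¹ *
      ((n : A) * k * (n : A)⁻¹) ∈ Y :=
  (exists_unique_conj_pow_mem hYX hidx n.2.1 n.2.2).choose_spec.1

/-- The exponent is CHARACTERISED by its defining property.
([IUTchI] Def 6.1 (v) p.158) [claim: Mochizuki2012, status: disputed] -/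
theorem conjExponent_eq_iff (hYX : Y ≤ X) [(Y.subgroupOf X).Normal] (hidx : Y.relIndex X = l)
    (n : ↥(Subgroup.normalizer (X : Set A) ⊓ Subgroup.normalizer (Y : Set A))) (u : (ZMod l)ˣ) :
    conjExponent Y X hYX hidx n = u ↔ ∀ k ∈ X, (k ^ (u : ZMod l).val)⁻¹ * ((n : A) * k * (n : A)⁻¹) ∈ Y := by
  constructor
  · rintro rfl
    exact conjExponent_spec hYX hidx n
  · intro h
    exact ((exists_unique_conj_pow_mem hYX hidx n.2.1 n.2.2).choose_spec.2 u h).symm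

/-- The exponent is the (L1)-exponent of the (L2)-automorphism: `conjExponent = mulAutExponent ∘ conjSubquot`.
([IUTchI] Def 6.1 (v) p.158) [claim: Mochizuki2012, status: disputed] -/
theorem mulAutExponent_conjSubquot (hYX : Y ≤ X) [(Y.subgroupOf X).Normal] (hidx : Y.relIndex X = l)
    (n : ↥(Subgroup.normalizer (X : Set A) ⊓ Subgroup.normalizer (Y : Set A))) :
    mulAutExponent (Q := X ⧸ Y.subgroupOf X) hidx (conjSubquot Y X hidx n) = conjExponent Y X hYX hidx n := by
  rw [mulAutExponent_eq_iff]
  intro q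
  induction q using QuotientGroup.induction_on with
  | H k =>
    rw [conjSubquot_apply_mk, ← QuotientGroup.mk_pow, eq_comm, QuotientGroup.eq, Subgroup.mem_subgroupOf,
      Subgroup.coe_mul, Subgroup.coe_inv, Subgroup.coe_pow]
    exact conjExponent_spec hYX hidx n k k.2

/-- **(L2a/b)** The exponent of an element of `X` is `1`. ([IUTchI] Def 6.1 (v) p.158) [claim: Mochizuki2012, status: disputed] -/
theorem conjExponent_eq_one_of_mem (hYX : Y ≤ X) [(Y.subgroupOf X).Normal] (hidx : Y.relIndex X = l)
    (n : ↥(Subgroup.normalizer (X : Set A) ⊓ Subgroup.normalizer (Y : Set A))) (hn : (n : A) ∈ X) :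
    conjExponent Y X hYX hidx n = 1 :=
  (conjExponent_eq_iff hYX hidx n 1).mpr (conj_pow_mem_of_mem hYX hidx hn)

/-- The exponent is CONSTANT ON `X`-COSETS (so it is well defined on `Aut(A/Y) = N_A(Y)/Y`,
`OrbitCat.autOfNormalizer_eq_iff`). ([IUTchI] Def 6.1 (v) p.158) [claim: Mochizuki2012, status: disputed] -/
theorem conjExponent_mul_of_mem (hYX : Y ≤ X) [(Y.subgroupOf X).Normal] (hidx : Y.relIndex X = l)
    (n x : ↥(Subgroup.normalizer (X : Set A) ⊓ Subgroup.normalizer (Y : Set A))) (hx : (x : A) ∈ X) :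
    conjExponent Y X hYX hidx (n * x) = conjExponent Y X hYX hidx n := by
  rw [map_mul, conjExponent_eq_one_of_mem hYX hidx x hx, mul_one]

/-- The exponent is `1` iff `n` centralises `X ⧸ Y`. ([IUTchI] Def 6.1 (v) p.158) [claim: Mochizuki2012, status: disputed] -/
theorem conjExponent_eq_one_iff (hYX : Y ≤ X) [(Y.subgroupOf X).Normal] (hidx : Y.relIndex X = l)
    (n : ↥(Subgroup.normalizer (X : Set A) ⊓ Subgroup.normalizer (Y : Set A))) :
    conjExponent Y X hYX hidx n = 1 ↔ ∀ k ∈ X, k⁻¹ * ((n : A) * k * (n : A)⁻¹) ∈ Y :=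
  conj_pow_mem_one_iff hYX hidx n.2.1 n.2.2 (conjExponent_spec hYX hidx n)

variable (Y X) in
/-- **(L3) `toFlStarOfNormalizer`**: the exponent character followed by `𝔽_l^× ↠ 𝔽_l^⋇ = 𝔽_l^×/{±1}` — the kit's
`toFlStar : Aut(𝒟^{⊚±}) → 𝔽_l^⋇` read on normaliser representatives ([IUTchI] Def 6.1 (v) p.158 "natural surjective
homomorphism `Aut(𝒟^{⊚±}) ↠ 𝔽_l^⋇`"; surjectivity is the binding's theorem, criterion `…_surjective_iff`).
([IUTchI] Def 6.1 (v) p.158) [claim: Mochizuki2012, status: disputed] -/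
noncomputable def toFlStarOfNormalizer (hYX : Y ≤ X) [(Y.subgroupOf X).Normal] (hidx : Y.relIndex X = l) :
    ↥(Subgroup.normalizer (X : Set A) ⊓ Subgroup.normalizer (Y : Set A)) →* FlStar l :=
  (QuotientGroup.mk' (unitsPlusMinus l)).comp (conjExponent Y X hYX hidx)

/-- `toFlStarOfNormalizer n` is the label of `conjExponent n`. ([IUTchI] Def 6.1 (v) p.158) [claim: Mochizuki2012, status: disputed] -/
theorem toFlStarOfNormalizer_apply (hYX : Y ≤ X) [(Y.subgroupOf X).Normal] (hidx : Y.relIndex X = l)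
    (n : ↥(Subgroup.normalizer (X : Set A) ⊓ Subgroup.normalizer (Y : Set A))) :
    toFlStarOfNormalizer Y X hYX hidx n = FlStar.mk l (conjExponent Y X hYX hidx n) := rfl

/-- **(L3)** `toFlStarOfNormalizer n = 1` for `n ∈ X` (so `Π_{X_K}`, in particular `Gal(X̲_K/X_K)` and `Aut_K`-lifts
inside `X`, map to `1`). ([IUTchI] Def 6.1 (v) p.158) [claim: Mochizuki2012, status: disputed] -/
theorem toFlStarOfNormalizer_eq_one_of_mem (hYX : Y ≤ X) [(Y.subgroupOf X).Normal]
    (hidx : Y.relIndex X = l) (n : ↥(Subgroup.normalizer (X : Set A) ⊓ Subgroup.normalizer (Y : Set A)))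
    (hn : (n : A) ∈ X) : toFlStarOfNormalizer Y X hYX hidx n = 1 := by
  rw [toFlStarOfNormalizer_apply, conjExponent_eq_one_of_mem hYX hidx n hn]
  rfl

/-- `toFlStarOfNormalizer` is constant on `X`-cosets (well defined on `N_A(Y)/Y`-classes of automorphisms).
([IUTchI] Def 6.1 (v) p.158) [claim: Mochizuki2012, status: disputed] -/
theorem toFlStarOfNormalizer_mul_of_mem (hYX : Y ≤ X) [(Y.subgroupOf X).Normal]
    (hidx : Y.relIndex X = l) (n x : ↥(Subgroup.normalizer (X : Set A) ⊓ Subgroup.normalizer (Y : Set A)))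
    (hx : (x : A) ∈ X) : toFlStarOfNormalizer Y X hYX hidx (n * x) = toFlStarOfNormalizer Y X hYX hidx n := by
  rw [toFlStarOfNormalizer_apply, toFlStarOfNormalizer_apply, conjExponent_mul_of_mem hYX hidx n x hx]

/-- **The `Aut_±` shape**: `toFlStarOfNormalizer n = 1` iff `n` acts on `X ⧸ Y` by `±1`.
([IUTchI] Def 6.1 (v) p.158) [claim: Mochizuki2012, status: disputed] -/
theorem toFlStarOfNormalizer_eq_one_iff (hYX : Y ≤ X) [(Y.subgroupOf X).Normal]
    (hidx : Y.relIndex X = l) (n : ↥(Subgroup.normalizer (X : Set A) ⊓ Subgroup.normalizer (Y : Set A))) :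
    toFlStarOfNormalizer Y X hYX hidx n = 1 ↔
      conjExponent Y X hYX hidx n = 1 ∨ conjExponent Y X hYX hidx n = -1 := by
  rw [toFlStarOfNormalizer_apply, FlStar.mk_eq_one_iff]

/-- **Surjectivity criterion** (the kit's `toFlStar_surjective` at the instance reduces to it): every unit of `ℤ/l`
is, UP TO SIGN, the exponent of some element of the joint normaliser ([IUTchI] Def 6.1 (v) p.158: supplied by
the split torus of "a Borel subgroup of `SL₂(𝔽_l)/{±1}`", Def 3.1 (c) — not proved here).
([IUTchI] Def 6.1 (v) p.158) [claim: Mochizuki2012, status: disputed] -/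
theorem toFlStarOfNormalizer_surjective_iff (hYX : Y ≤ X) [(Y.subgroupOf X).Normal]
    (hidx : Y.relIndex X = l) :
    Function.Surjective (toFlStarOfNormalizer Y X hYX hidx) ↔
      ∀ u : (ZMod l)ˣ, ∃ n : ↥(Subgroup.normalizer (X : Set A) ⊓ Subgroup.normalizer (Y : Set A)),
        conjExponent Y X hYX hidx n = u ∨ conjExponent Y X hYX hidx n = -u :=
  FlStar.mk'_comp_surjective_iff _

end Subquotient

end Literature.IUT.HodgeTheaters
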